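import Literature.Probability.RandomPlanarGeometry.SAWTriangularPolygonMono
import Literature.Probability.RandomPlanarGeometry.SAWTriangularBridgeConstant
import Literature.Probability.RandomPlanarGeometry.BrownianLoopMassCore
import Mathlib.Analysis.SpecialFunctions.Pow.Real
import HarnessLib

/-!
# Self-avoiding polygons of the triangular lattice grow at rate `μ(𝕋)`: Hammersley's theorem in the brick frame

Topic `Literature/Probability/RandomPlanarGeometry` (lane «pcv-sawmu», door «TRI-SAP»; closes the chain
`SAWTriangularPolygonPairs.lean` (two bridges make a polygon: `b_M(𝕋)² ≤ (2M+2)⁴ · triLoopCount (2M+2)`) →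
`SAWTriangularPolygonMono.lean` (`triLoopCount N ≤ triLoopCount (N+1)`, hence the odd lengths) with the
Hammersley–Welsh envelope `c_N(𝕋) ≤ e^{15√N} μ^N` (`SAWTriangularHammersleyWelsh.lean`) and the bridge envelope
`e^{−15√n} μ^n ≤ b_n(𝕋)` (`SAWTriangularBridgeConstant.lean`)). Sources and status in print (lit-2 gen 12 cell):
J. M. Hammersley, *The number of polygons on a lattice*, Proc. Cambridge Philos. Soc. 57 (1961) 516–523 proves
`μ_polygon = μ_walk` for the HYPERCUBIC lattice `ℤ^d`, `d ≥ 2` (p. 516, definitions: integer coordinates, unit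
steps; "a polygon must have an even number of sides"; eq. (2)) [key `Hammersley1961Polygons`; the full text is not
held, acq-10237]; N. Madras, G. Slade, *The Self-Avoiding Walk* (1993), §3.2, Theorem 3.2.3 (p. 64), Theorem 3.2.4
(p. 65), Corollaries 3.2.5–3.2.6 with eq. (3.2.9) (pp. 67–68), Notes p. 75 (on `ℤ^d`: `lim_{N even} q_N^{1/N} = μ`
via `b_M² ≤ … q_{2M+2}` and `q_N ≤ c_{N−1}`); restated for "a periodic graph or lattice" without proof in
A. J. Guttmann, *Self-avoiding walks and polygons — an overview*, arXiv:1212.3448 (2012), §2.1–§2.2 (key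
`Guttmann2012SAWOverview`). For the triangular lattice we have located no printed proof — the present file
supplies one (first kernel text; M–S §3.2 architecture: bridge pairs → polygons, plus the `𝕋`-specific odd
lengths). Here `triLoopCount N = 2N · q_N(𝕋)` (M–S (3.2.1)) counts rooted oriented `N`-gons, and on `𝕋` the
limit is along ALL `N` (no parity).

What is proved (kernel text new; the squeeze `abs_log_triLoopCount_sub_le` / `triSAPLimit_holds` is a-idea-1
gen 13's glue `Sketch_G13_TriSAP` §Glue carried verbatim up to the by-name inputs):
* `abs_log_triLoopCount_sub_le`: for `N ≥ 4`, `0 < triLoopCount N` and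
  `|log (triLoopCount N) − N · logMuTri| ≤ (53 + 3 · logMuTri) · √N` (the (3.2.9) squeeze with explicit
  stretched-exponential corrections — the two-sided envelope the polygon RATIO theorems start from);
* `TriSAPLimit` (the door's face, a-idea-1 gen 13, token-for-token) and `triSAPLimit_holds : TriSAPLimit`:
  `(triLoopCount N)^{1/N} → μ(𝕋) = exp logMuTri` as `N → ∞` — Hammersley's 1961 theorem on the triangular
  lattice in the rooted-oriented normalisation, and `TriSAPLimitQ` / `triSAPLimitQ_holds`: the printed
  normalisation `q_N(𝕋)^{1/N} → μ(𝕋)`, `q_N = triLoopCount N / (2N)` (the factor `(2N)^{1/N} → 1`).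
-/

namespace Literature.Probability.RandomPlanarGeometry.SAW

open Real Filter Topology Finset

/-- **Hammersley's theorem on `𝕋` (face «TRI-SAP», a-idea-1 gen 13 token-for-token):** the number
`triLoopCount N = 2N·q_N(𝕋)` of rooted oriented `N`-step self-avoiding polygons of the triangular lattice satisfies
`(triLoopCount N)^{1/N} → μ(𝕋)`. [cite: MadrasSlade1993, §3.2 Cor. 3.2.5 (3.2.9) p. 67 (ℤ^d, even N)]
[cite: Hammersley1961Polygons, p. 516 and eq. (2) (ℤ^d, d ≥ 2)] [cite: Guttmann2012SAWOverview, §2.1–§2.2 (periodic lattices, no proof)] -/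
def TriSAPLimit : Prop :=
  Tendsto (fun N : ℕ => (triLoopCount N : ℝ) ^ (1 / (N : ℝ))) atTop (𝓝 (Real.exp logMuTri))

/-- **The (3.2.9) squeeze on `𝕋`, quantitative form.** For `N ≥ 4`: `triLoopCount N > 0` and
`|log (triLoopCount N) − N·log μ(𝕋)| ≤ (53 + 3 log μ(𝕋)) √N`. Lower side: with `M = ⌊(N−2)/2⌋`,
`(e^{−15√M} μ^M)² ≤ b_M² ≤ (2M+2)⁴ · triLoopCount N ≤ N⁴ · triLoopCount N` (two bridges make a polygon,
plus one-edge growth for odd `N`, plus the bridge envelope); upper side: `triLoopCount N ≤ c_{N−1} ≤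
e^{15√N} μ^N` (Hammersley–Welsh). Glue text: a-idea-1 gen 13.
[cite: MadrasSlade1993, §3.2 Thm 3.2.3 p. 64, (3.2.5) p. 65, Thm 3.2.4 p. 65, Cor. 3.2.5 (3.2.9) p. 67] -/
theorem abs_log_triLoopCount_sub_le {N : ℕ} (hN : 4 ≤ N) :
    0 < (triLoopCount N : ℝ) ∧
      |Real.log (triLoopCount N) - N * logMuTri| ≤ (53 + 3 * logMuTri) * Real.sqrt N := by
  have hL : 0 ≤ logMuTri := logMuTri_pos.le
  set L := logMuTri with hLdef
  set μ := Real.exp L with hμdef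
  have hμ1 : 1 ≤ μ := Real.one_le_exp hL
  have hμ0 : 0 < μ := Real.exp_pos _
  have hNr : (4 : ℝ) ≤ N := by exact_mod_cast hN
  have hs1 : 1 ≤ Real.sqrt N := by
    rw [show (1 : ℝ) = Real.sqrt 1 by simp]; exact Real.sqrt_le_sqrt (by linarith)
  have hs0 : 0 < Real.sqrt N := by linarith
  have hlogN : Real.log N ≤ 2 * Real.sqrt N := log_le_two_mul_sqrt (by linarith)
  have hlogN0 : 0 ≤ Real.log N := Real.log_nonneg (by linarith)
  -- the index `M` of the bridge pair
  set M := (N - 2) / 2 with hMdef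
  have hM : 1 ≤ M := by omega
  have hMN : N = 2 * M + 2 ∨ N = 2 * M + 3 := by omega
  have hMr : 2 * (M : ℝ) + 2 ≤ N := by
    rcases hMN with h | h
    · exact_mod_cast (by omega : 2 * M + 2 ≤ N)
    · exact_mod_cast (by omega : 2 * M + 2 ≤ N)
  have hMr' : (N : ℝ) - 3 ≤ 2 * M := by
    rcases hMN with h | h
    · have : ((N : ℕ) : ℝ) = 2 * M + 2 := by exact_mod_cast h
      linarith
    · have : ((N : ℕ) : ℝ) = 2 * M + 3 := by exact_mod_cast h
      linarith
  have hsM : Real.sqrt M ≤ Real.sqrt N := Real.sqrt_le_sqrt (by linarith)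
  -- lower bound: `(e^{-15√M} μ^M)^2 ≤ b_M^2 ≤ (2M+2)^4 t_N ≤ N^4 t_N`
  have hpair : (brickBridgeCount M : ℝ) ^ 2 ≤ (2 * (M : ℝ) + 2) ^ 4 * triLoopCount N := by
    rcases hMN with h | h
    · have := sq_brickBridgeCount_le_mul_triLoopCount M hM
      rw [congrArg triLoopCount h.symm] at this; exact_mod_cast this
    · have := sq_brickBridgeCount_le_mul_triLoopCount_odd M hM
      rw [congrArg triLoopCount h.symm] at this; exact_mod_cast this
  have hb := exp_neg_mul_pow_le_brickBridgeCount M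
  have hb0 : 0 < Real.exp (-(15 * Real.sqrt M)) * μ ^ M := by positivity
  have hlow : (Real.exp (-(15 * Real.sqrt M)) * μ ^ M) ^ 2 ≤ (N : ℝ) ^ 4 * triLoopCount N :=
    calc (Real.exp (-(15 * Real.sqrt M)) * μ ^ M) ^ 2 ≤ (brickBridgeCount M : ℝ) ^ 2 :=
          pow_le_pow_left₀ hb0.le hb 2
      _ ≤ (2 * (M : ℝ) + 2) ^ 4 * triLoopCount N := hpair
      _ ≤ (N : ℝ) ^ 4 * triLoopCount N :=
          mul_le_mul_of_nonneg_right (pow_le_pow_left₀ (by positivity) hMr 4) (Nat.cast_nonneg _)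
  have hN4 : 0 < (N : ℝ) ^ 4 := by positivity
  have ht0 : 0 < (triLoopCount N : ℝ) := by
    by_contra h
    have h' : (triLoopCount N : ℝ) ≤ 0 := not_lt.1 h
    have : (Real.exp (-(15 * Real.sqrt M)) * μ ^ M) ^ 2 ≤ 0 := hlow.trans (by nlinarith)
    exact absurd this (not_le.2 (by positivity))
  refine ⟨ht0, abs_le.2 ⟨?_, ?_⟩⟩
  · -- lower: log t_N ≥ 2 log(e^{-15√M} μ^M) - 4 log N ≥ (N-3) L - 30 √N - 8 √N
    have h1 : Real.log ((Real.exp (-(15 * Real.sqrt M)) * μ ^ M) ^ 2) ≤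
        Real.log ((N : ℝ) ^ 4 * triLoopCount N) := Real.log_le_log (by positivity) hlow
    rw [Real.log_pow, Real.log_mul (Real.exp_pos _).ne' (pow_pos hμ0 _).ne', Real.log_exp, Real.log_pow,
      hμdef, Real.log_exp, Real.log_mul hN4.ne' ht0.ne', Real.log_pow] at h1
    push_cast at h1
    nlinarith [hsM, hMr', hlogN, hs1, hL, Real.sqrt_nonneg (M : ℝ)]
  · -- upper: t_N ≤ c_{N-1} ≤ e^{15√(N-1)} μ^{N-1} ≤ e^{15√N} μ^N
    have hup : (triLoopCount N : ℝ) ≤ Real.exp (15 * Real.sqrt N) * μ ^ N := by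
      have h1 : (triLoopCount N : ℝ) ≤ triSawCount (N - 1) := by exact_mod_cast triLoopCount_le N
      refine h1.trans ((triSawCount_le_exp_mul_pow (N - 1) (by omega)).trans ?_)
      have hs : Real.sqrt ((N - 1 : ℕ) : ℝ) ≤ Real.sqrt N :=
        Real.sqrt_le_sqrt (by exact_mod_cast Nat.sub_le N 1)
      exact mul_le_mul (Real.exp_le_exp.2 (by linarith)) (pow_le_pow_right₀ hμ1 (Nat.sub_le N 1))
        (pow_nonneg hμ0.le _) (Real.exp_pos _).le
    have h2 : Real.log (triLoopCount N) ≤ Real.log (Real.exp (15 * Real.sqrt N) * μ ^ N) :=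
      Real.log_le_log ht0 hup
    rw [Real.log_mul (Real.exp_pos _).ne' (pow_pos hμ0 _).ne', Real.log_exp, Real.log_pow, hμdef,
      Real.log_exp] at h2
    nlinarith [hs1, hL]

/-- `log (triLoopCount N) / N → log μ(𝕋)`: the polygon and walk connective constants of `𝕋` coincide
(logarithmic form of Hammersley's theorem). [cite: MadrasSlade1993, §3.2 Thm 3.2.3 p. 64, Cor. 3.2.5 p. 67] -/
theorem tendsto_log_triLoopCount_div :
    Tendsto (fun N : ℕ => Real.log (triLoopCount N) / N) atTop (𝓝 logMuTri) := by
  set C := 53 + 3 * logMuTri with hC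
  have herr : Tendsto (fun N : ℕ => C / Real.sqrt N) atTop (𝓝 0) :=
    tendsto_const_nhds.div_atTop (Real.tendsto_sqrt_atTop.comp tendsto_natCast_atTop_atTop)
  have hlo : Tendsto (fun N : ℕ => logMuTri - C / Real.sqrt N) atTop (𝓝 logMuTri) := by
    simpa using (tendsto_const_nhds (x := logMuTri)).sub herr
  have hhi : Tendsto (fun N : ℕ => logMuTri + C / Real.sqrt N) atTop (𝓝 logMuTri) := by
    simpa using (tendsto_const_nhds (x := logMuTri)).add herr
  refine tendsto_of_tendsto_of_tendsto_of_le_of_le' hlo hhi ?_ ?_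
  · filter_upwards [eventually_ge_atTop 4] with N hN
    obtain ⟨ht0, hb⟩ := abs_log_triLoopCount_sub_le hN
    rw [← hC] at hb
    have hN0 : (0 : ℝ) < N := by exact_mod_cast (by omega : 0 < N)
    have hs0 : 0 < Real.sqrt N := Real.sqrt_pos.2 hN0
    have h1 := (abs_le.1 hb).1
    rw [le_div_iff₀ hN0]
    have e : (logMuTri - C / Real.sqrt N) * N = N * logMuTri - C * Real.sqrt N := by
      have : (N : ℝ) = Real.sqrt N * Real.sqrt N := (Real.mul_self_sqrt hN0.le).symm
      field_simp
      linear_combination (-C) * this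
    linarith [e]
  · filter_upwards [eventually_ge_atTop 4] with N hN
    obtain ⟨ht0, hb⟩ := abs_log_triLoopCount_sub_le hN
    rw [← hC] at hb
    have hN0 : (0 : ℝ) < N := by exact_mod_cast (by omega : 0 < N)
    have hs0 : 0 < Real.sqrt N := Real.sqrt_pos.2 hN0
    have h1 := (abs_le.1 hb).2
    rw [div_le_iff₀ hN0]
    have e : (logMuTri + C / Real.sqrt N) * N = N * logMuTri + C * Real.sqrt N := by
      have : (N : ℝ) = Real.sqrt N * Real.sqrt N := (Real.mul_self_sqrt hN0.le).symm
      field_simp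
      linear_combination C * this
    linarith [e]

/-- **Hammersley's theorem on the triangular lattice (door «TRI-SAP» closed):** `(triLoopCount N)^{1/N} → μ(𝕋)`,
i.e. `μ_polygon(𝕋) = μ(𝕋)`, along all `N`. Glue text: a-idea-1 gen 13.
[cite: MadrasSlade1993, §3.2 Cor. 3.2.5 (3.2.9) p. 67] [cite: Hammersley1961Polygons]
[cite: Guttmann2012SAWOverview, §2.2] -/
theorem triSAPLimit_holds : TriSAPLimit := by
  unfold TriSAPLimit
  have hexp := (Real.continuous_exp.tendsto logMuTri).comp tendsto_log_triLoopCount_div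
  refine hexp.congr' ?_
  filter_upwards [eventually_ge_atTop 4] with N hN
  obtain ⟨ht0, -⟩ := abs_log_triLoopCount_sub_le hN
  simp only [Function.comp]
  rw [Real.rpow_def_of_pos ht0, mul_one_div]

/-- The printed normalisation (face «TRI-SAP-Q», a-idea-1 gen 13 token-for-token): `q_N(𝕋)^{1/N} → μ(𝕋)` with
`q_N = triLoopCount N / (2N)` the number of `N`-step self-avoiding polygons of `𝕋` per site (M–S (3.2.1), (3.2.9)).
[cite: MadrasSlade1993, §3.2 (3.2.1) p. 65, Cor. 3.2.5 (3.2.9) p. 67] [cite: Hammersley1961Polygons] -/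
def TriSAPLimitQ : Prop :=
  Tendsto (fun N : ℕ => ((triLoopCount N : ℝ) / (2 * N)) ^ (1 / (N : ℝ))) atTop (𝓝 (Real.exp logMuTri))

/-- `log (2N) / N → 0` along the naturals. [folklore] -/
private theorem tendsto_log_two_mul_div :
    Tendsto (fun N : ℕ => Real.log (2 * N) / N) atTop (𝓝 0) := by
  have h1 : Tendsto (fun x : ℝ => Real.log x ^ 1 / (1 * x + 0)) atTop (𝓝 0) :=
    Real.tendsto_pow_log_div_mul_add_atTop 1 0 1 one_ne_zero
  have h2 : Tendsto (fun N : ℕ => Real.log N / N) atTop (𝓝 0) := by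
    have := h1.comp tendsto_natCast_atTop_atTop
    refine this.congr' (Eventually.of_forall fun N => ?_)
    simp [Function.comp]
  have h3 : Tendsto (fun N : ℕ => Real.log 2 / N) atTop (𝓝 0) :=
    tendsto_const_nhds.div_atTop tendsto_natCast_atTop_atTop
  have h4 := h3.add h2
  rw [add_zero] at h4
  refine h4.congr' ?_
  filter_upwards [eventually_ge_atTop 1] with N hN
  have hN0 : (0 : ℝ) < N := by exact_mod_cast (by omega : 0 < N)
  rw [Real.log_mul two_ne_zero hN0.ne', add_div]

/-- **Hammersley's theorem on `𝕋`, printed normalisation:** `q_N(𝕋)^{1/N} → μ(𝕋)` along all `N`, where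
`q_N(𝕋) = triLoopCount N / (2N)` is the number of `N`-step self-avoiding polygons per site.
[cite: MadrasSlade1993, §3.2 Thm 3.2.3 p. 64, (3.2.5) p. 65, Cor. 3.2.5 (3.2.9) p. 67] [cite: Hammersley1961Polygons] -/
theorem triSAPLimitQ_holds : TriSAPLimitQ := by
  unfold TriSAPLimitQ
  have hg : Tendsto (fun N : ℕ => (Real.log (triLoopCount N) - Real.log (2 * N)) / N) atTop (𝓝 logMuTri) := by
    have := tendsto_log_triLoopCount_div.sub tendsto_log_two_mul_div
    rw [sub_zero] at this
    refine this.congr' (Eventually.of_forall fun N => ?_)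
    simp only [sub_div]
  have hexp := (Real.continuous_exp.tendsto logMuTri).comp hg
  refine hexp.congr' ?_
  filter_upwards [eventually_ge_atTop 4] with N hN
  obtain ⟨ht0, -⟩ := abs_log_triLoopCount_sub_le hN
  have hN0 : (0 : ℝ) < 2 * N := by positivity
  have hq0 : 0 < (triLoopCount N : ℝ) / (2 * N) := div_pos ht0 hN0
  simp only [Function.comp]
  rw [Real.rpow_def_of_pos hq0, Real.log_div ht0.ne' hN0.ne', mul_one_div]

end Literature.Probability.RandomPlanarGeometry.SAW
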